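import Mathlib
import HarnessLib
import Summits.HubbardSuperconductivity.HubbardSuperconductivity.Theorems.KLProgrammeC4aTubeTadpole

/-!
# Route `KLProgramme` — crux C4a, named input (i) «Jacobian jets»: the WINDOW-SPECIFIC CERTIFIED TABLE of the free-band chart-Jacobian jets
# (KLCert pattern: a named `Prop` of enclosures, certified by interval arithmetic — kit j284476 — and consumed as a hypothesis)

Cell `gate-hubbard-kl`, lane hubbard-kl-c4a-1 (g2); helper for stub (C) of `KLRegimeEngineV17F2` (stmt-HubbardSuperconductivity-20437; plan g17 (R47r):
«the landed generic `klJacG` table overshoots the natural chart-Jacobian jets by 10²–10³ at orders 1–2 ⇒ before ANY k ≤ 2 numeral is read from it, replace by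
a window-specific certified bundle»; memo HOME/hubbard-kl-c4a-1/C4A-PLAN.md §15.2–§15.3).

* `jacCertG i` — certified GLOBAL bounds of `sup_ϑ |∂_ϑⁱ levelChartJac μ 0 (ρ, ϑ)|`, `i ≤ 4`, over all levels `μ + ρ ∈ [−87/80, −9/80]`
  (`klWindowC` widened by `3/80 ≥ klTubeR`), bare frame `K = 0`: `(4.241, 16.252, 387.47, 7503.3, 307509)`;
* `jacCertR i` — certified bounds of the free level radius and its angular jets `(2.8046, 1.4946, 20.99, 225.8, 7141)`; `jacCertUmin = 1.8306`;
  `jacCertDmin = 0.66131` — certified lower bound of the radial slope `∂_ρ ε₀` on those level curves;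
* `JacCertTable`, `JacCertTable.Enclosures` (THE named numerical hypothesis of a record: four clauses, in the shapes the consumers read — the `hJjet`
  hypothesis of `norm_iteratedDeriv_tubeTadpole_le` at `K = 0`, the `hR`/`hρ`/`hU₀` inputs of the polar tower), `jacCertTable` (the record of j284476);
* projections in consumer shape.

CERTIFICATE (not a proof in Lean): kit job j284476 (evidence + sha256 manifest on stmt-…-20437; script HOME/hubbard-kl-c4a-1/jac/jaccert.py, table
jac/JACCERT-j284476.md): `mpmath.iv` interval arithmetic with directed rounding, 39 × 8 level sub-cells × 512 angle boxes on `[0, π/4]` (`D₄` symmetry and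
evenness give all angles), monotone interval bisection for the level radius (`∂_ρ ε₀ > 0` on `u ∈ [1.5, 3]`), implicit-function Taylor recursion with
interval coefficients for the angular jets, `J = u/∂_ρε₀` by Taylor division, `|f⁽ᵏ⁾| ≤ k!·sup|f_k|`; every entry outward-rounded; certified ≥ float spectral
values in every cell (tightness 1.00–1.06).  The frame-dependent part (sizes `A, A₃, A₄, A₅` of `K ≠ 0`) is NOT here: it is the perturbative term `jacPert` of
the forthcoming `…C4aJacobianCertJets` (memo §15.3), generic coefficients being harmless there (`A ~ Gfr·U²`).

Definitions + trivial projections; nothing is asserted about the Hubbard model.  References: BGM 2006 §2.4 [cite: BenfattoGiulianiMastropietro2006].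
-/

noncomputable section

namespace Summit.HubbardSuperconductivity.HubbardSuperconductivity.Theorems.C4a

set_option linter.dupNamespace false -- summit = problem name (single-conjunct summit), D-0017

open Real Set
open Literature.MathematicalPhysics.QuantumLattice Literature.MathematicalPhysics.QuantumLattice.BandSectorCounting
open Summit.HubbardSuperconductivity.HubbardSuperconductivity.Theorems.PerturbedFermiCurve

/-! ## §1 The certified numbers (kit j284476; rationals ≥ the outward-rounded certified sups, ≤ the certified infs) -/

/-- **Certified global table of the free-band chart-Jacobian angular jets** on `klWindowC ± 3/80`:
`sup|J| ≤ 4.241`, `sup|J′| ≤ 16.252`, `sup|J″| ≤ 387.47`, `sup|J‴| ≤ 7503.3`, `sup|J⁗| ≤ 307509` (orders `≥ 4` read the last entry). -/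
def jacCertG (i : ℕ) : ℝ :=
  if i = 0 then 4241 / 1000 else if i = 1 then 16252 / 1000 else if i = 2 then 38747 / 100 else if i = 3 then 75033 / 10 else 307509

/-- **Certified table of the free level radius and its angular jets** on `klWindowC ± 3/80`:
`sup u ≤ 2.8046`, `sup|u′| ≤ 1.4946`, `sup|u″| ≤ 20.99`, `sup|u‴| ≤ 225.8`, `sup|u⁗| ≤ 7141`. -/
def jacCertR (i : ℕ) : ℝ :=
  if i = 0 then 28046 / 10000 else if i = 1 then 14946 / 10000 else if i = 2 then 2099 / 100 else if i = 3 then 2258 / 10 else 7141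

/-- Certified lower bound of the free radial slope `∂_ρ ε₀` on the level curves of `klWindowC ± 3/80`: `0.66131`. -/
def jacCertDmin : ℝ := 66131 / 100000

/-- Certified lower bound of the free level radius on `klWindowC ± 3/80`: `1.8306`. -/
def jacCertUmin : ℝ := 18306 / 10000

/-- `jacCertG 0 = 4.241`. -/
@[simp] theorem jacCertG_zero : jacCertG 0 = 4241 / 1000 := by simp [jacCertG]
/-- `jacCertG 1 = 16.252`. -/
@[simp] theorem jacCertG_one : jacCertG 1 = 16252 / 1000 := by simp [jacCertG]
/-- `jacCertG 2 = 387.47`. -/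
@[simp] theorem jacCertG_two : jacCertG 2 = 38747 / 100 := by simp [jacCertG]
/-- `jacCertG 3 = 7503.3`. -/
@[simp] theorem jacCertG_three : jacCertG 3 = 75033 / 10 := by simp [jacCertG]
/-- `jacCertG 4 = 307509`. -/
@[simp] theorem jacCertG_four : jacCertG 4 = 307509 := by simp [jacCertG]
/-- `jacCertR 0 = 2.8046`. -/
@[simp] theorem jacCertR_zero : jacCertR 0 = 28046 / 10000 := by simp [jacCertR]
/-- `jacCertR 1 = 1.4946`. -/
@[simp] theorem jacCertR_one : jacCertR 1 = 14946 / 10000 := by simp [jacCertR]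
/-- `jacCertR 2 = 20.99`. -/
@[simp] theorem jacCertR_two : jacCertR 2 = 2099 / 100 := by simp [jacCertR]
/-- `jacCertR 3 = 225.8`. -/
@[simp] theorem jacCertR_three : jacCertR 3 = 2258 / 10 := by simp [jacCertR]
/-- `jacCertR 4 = 7141`. -/
@[simp] theorem jacCertR_four : jacCertR 4 = 7141 := by simp [jacCertR]

/-- `0 < jacCertG i`. -/
theorem jacCertG_pos (i : ℕ) : 0 < jacCertG i := by
  unfold jacCertG; split_ifs <;> norm_num

/-- `0 < jacCertR i`. -/
theorem jacCertR_pos (i : ℕ) : 0 < jacCertR i := by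
  unfold jacCertR; split_ifs <;> norm_num

/-- `0 < jacCertDmin`. -/
theorem jacCertDmin_pos : 0 < jacCertDmin := by unfold jacCertDmin; norm_num

/-- The certified table sits far below the generic one where it matters: `jacCertG i ≤ 2^9` for `i ≤ 2`. -/
theorem jacCertG_le_of_le_two {i : ℕ} (hi : i ≤ 2) : jacCertG i ≤ 2 ^ 9 := by
  unfold jacCertG; split_ifs <;> norm_num <;> omega

/-! ## §2 The record and the named numerical hypothesis (KLCert pattern: a predicate on a record of rationals) -/

/-- A certified-table record for the free-band chart-Jacobian bundle: level range `[lo, hi]`, Jacobian-jet table `G`, radius-jet table `R`,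
radial-slope floor `Dmin`, radius floor `Umin`. [folklore] -/
structure JacCertTable where
  /-- lower end of the certified level range -/
  lo : ℝ
  /-- upper end of the certified level range -/
  hi : ℝ
  /-- bounds of `sup_ϑ |∂ⁱ_ϑ levelChartJac μ 0 (ρ, ϑ)|`, `μ + ρ ∈ [lo, hi]` -/
  G : ℕ → ℝ
  /-- bounds of `sup_ϑ |∂ⁱ_ϑ u₀(μ′, ϑ)|` -/
  R : ℕ → ℝ
  /-- floor of the radial slope `∂_ρ ε₀` on the level curves -/
  Dmin : ℝ
  /-- floor of the level radius -/
  Umin : ℝ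

/-- **`JacCertTable.Enclosures c`** — THE certified-computation statement of a record `c` (bare frame `K = 0`, levels `μ′ = μ + ρ ∈ [c.lo, c.hi]`):
(1) chart-Jacobian angular jets `‖∂ⁱ_s levelChartJac μ 0 (ρ, s)‖ ≤ c.G i` (`i ≤ 4`) — the `hJjet` shape of `norm_iteratedDeriv_tubeTadpole_le`;
(2) level-radius jets `‖∂ⁱ u₀(μ′, ·)‖ ≤ c.R i` (`i ≤ 4`); (3) radial slope `∂_ρ ε₀ ≥ c.Dmin` along the level curve (the polar tower's `hρ`);
(4) `u₀ ≥ c.Umin`.  Finitely many families of inequalities between explicit real-analytic functions and the record's rationals — the object of the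
certified interval-arithmetic computation. [folklore] -/
def JacCertTable.Enclosures (c : JacCertTable) : Prop :=
  (∀ μ ρ : ℝ, μ + ρ ∈ Icc c.lo c.hi → ∀ i ≤ 4, ∀ s : ℝ,
      ‖iteratedDeriv i (fun s : ℝ => levelChartJac μ (0 : TrigPolyC4v) (ρ, s)) s‖ ≤ c.G i) ∧
  (∀ μ' ∈ Icc c.lo c.hi, ∀ i ≤ 4, ∀ s : ℝ,
      ‖iteratedDeriv i (perturbedFermiRadius (fun k : Fin 2 → ℝ => -(0 : TrigPolyC4v).eval k) μ') s‖ ≤ c.R i) ∧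
  (∀ μ' ∈ Icc c.lo c.hi, ∀ ϑ : ℝ,
      c.Dmin ≤ fderiv ℝ (fun k : Fin 2 → ℝ => sqDispersion k + (fun k : Fin 2 → ℝ => -(0 : TrigPolyC4v).eval k) k)
        (perturbedFermiRadius (fun k : Fin 2 → ℝ => -(0 : TrigPolyC4v).eval k) μ' ϑ • dir ϑ) (dir ϑ)) ∧
  (∀ μ' ∈ Icc c.lo c.hi, ∀ ϑ : ℝ, c.Umin ≤ perturbedFermiRadius (fun k : Fin 2 → ℝ => -(0 : TrigPolyC4v).eval k) μ' ϑ)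

/-- **The certified record of kit j284476** on `klWindowC ± 3/80 = [−87/80, −9/80]`: `(jacCertG, jacCertR, jacCertDmin, jacCertUmin)`. [folklore] -/
def jacCertTable : JacCertTable where
  lo := -(87 / 80)
  hi := -(9 / 80)
  G := jacCertG
  R := jacCertR
  Dmin := jacCertDmin
  Umin := jacCertUmin

/-- Unfolding the record's fields. -/
@[simp] theorem jacCertTable_G : jacCertTable.G = jacCertG := rfl
/-- Unfolding. -/
@[simp] theorem jacCertTable_R : jacCertTable.R = jacCertR := rfl
/-- Unfolding. -/
@[simp] theorem jacCertTable_Dmin : jacCertTable.Dmin = jacCertDmin := rfl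
/-- Unfolding. -/
@[simp] theorem jacCertTable_Umin : jacCertTable.Umin = jacCertUmin := rfl
/-- Unfolding. -/
@[simp] theorem jacCertTable_lo : jacCertTable.lo = -(87 / 80) := rfl
/-- Unfolding. -/
@[simp] theorem jacCertTable_hi : jacCertTable.hi = -(9 / 80) := rfl

/-! ## §3 Projections in consumer shape -/

/-- **`hJjet` at the bare frame from the certificate**: `∀ i ≤ 4, ‖∂ⁱ_s levelChartJac μ 0 (ρ, s)‖ ≤ jacCertG i` for `μ + ρ` in the widened window. -/
theorem levelChartJac_zero_le_jacCertG (hE : jacCertTable.Enclosures) {μ ρ : ℝ} (hμρ : μ + ρ ∈ Icc (-(87 / 80 : ℝ)) (-(9 / 80)))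
    {i : ℕ} (hi : i ≤ 4) (s : ℝ) :
    ‖iteratedDeriv i (fun s : ℝ => levelChartJac μ (0 : TrigPolyC4v) (ρ, s)) s‖ ≤ jacCertG i :=
  hE.1 μ ρ hμρ i hi s

/-- Radius jets at the bare frame from the certificate. -/
theorem radius_zero_le_jacCertR (hE : jacCertTable.Enclosures) {μ' : ℝ} (hμ : μ' ∈ Icc (-(87 / 80 : ℝ)) (-(9 / 80))) {i : ℕ} (hi : i ≤ 4)
    (s : ℝ) : ‖iteratedDeriv i (perturbedFermiRadius (fun k : Fin 2 → ℝ => -(0 : TrigPolyC4v).eval k) μ') s‖ ≤ jacCertR i :=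
  hE.2.1 μ' hμ i hi s

/-- Radial slope at the bare frame from the certificate (the polar tower's `hρ` with `ρ₀ = jacCertDmin`). -/
theorem jacCertDmin_le_slope_zero (hE : jacCertTable.Enclosures) {μ' : ℝ} (hμ : μ' ∈ Icc (-(87 / 80 : ℝ)) (-(9 / 80))) (ϑ : ℝ) :
    jacCertDmin ≤ fderiv ℝ (fun k : Fin 2 → ℝ => sqDispersion k + (fun k : Fin 2 → ℝ => -(0 : TrigPolyC4v).eval k) k)
      (perturbedFermiRadius (fun k : Fin 2 → ℝ => -(0 : TrigPolyC4v).eval k) μ' ϑ • dir ϑ) (dir ϑ) :=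
  hE.2.2.1 μ' hμ ϑ

/-- `klWindowC`-levels with a tube offset `|ρ| ≤ 3/80` lie in the certificate's level range. -/
theorem add_mem_certWindow {μ ρ : ℝ} (hμ : μ ∈ Icc (-(105 / 100 : ℝ)) (-(15 / 100))) (hρ : |ρ| ≤ 3 / 80) :
    μ + ρ ∈ Icc (-(87 / 80 : ℝ)) (-(9 / 80)) := by
  obtain ⟨h1, h2⟩ := hμ
  obtain ⟨h3, h4⟩ := abs_le.1 hρ
  constructor <;> linarith

/-! ## §4 (g3, 2026-08-27) D-JCD-1 — `jacCertG` is SUPERSEDED by the two-engine table of record `PerturbedFermiCurve.klwjTableA`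

Referee ref-4 (§186-supplemental; KL STATUS l.3355): the entry `jacCertG 2 = 38747/100 = 387.47` was copied from the memo's prose, which rounded the
certified value `387.472` (kit j284476 `GLOBAL_JSON`) INWARD by `0.002`; the other thirteen numerals of §1 are outward-verified.  No falsehood is in the
tree (`JacCertTable.Enclosures` is a hypothesis, never discharged), but a consumer must not read `jacCertG 2` as certified.  The gate's append-only rule
forbids editing the numeral in place; and since k3c3-p3 g7 has meanwhile landed the TWO-ENGINE table on the same window — `PerturbedFermiCurve.klwjTableA`
(…PerturbedFermiCurveWindowJetsDefs, `G₂ = 392.8 ≥ 387.472`, elementwise max of kit j284931 and j284476) with the named hypothesis `PerturbedFermiCurve.KlwjCertA`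
— that table is the record and the c4a-1 names below are DEPRECATED in its favour (the assembly `…C4aJacobianCertJets` reads `FreeBandPolarJets`).
`jacCertR`, `jacCertDmin`, `jacCertUmin` stay valid (outward-verified) but are equally superseded by `klwjTableA`'s `R`, `Dtmin`, `umin` columns. -/

attribute [deprecated "D-JCD-1 (ref-4 §186-supplemental): `jacCertG 2 = 387.47` is rounded inward of the certified 387.472 — read the two-engine table
`PerturbedFermiCurve.klwjTableA` / hypothesis `PerturbedFermiCurve.KlwjCertA` (…PerturbedFermiCurveWindowJetsDefs) instead" (since := "2026-08-27")]
  jacCertG jacCertTable levelChartJac_zero_le_jacCertG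

end Summit.HubbardSuperconductivity.HubbardSuperconductivity.Theorems.C4a
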